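import Summits.ResolutionOfSingularities.ResolutionOfSingularities.Theorems.HilbertSamuelEliminationSigmaMaxModificationsCorridor3SigmaMenuGateTameSplit
import Literature.AlgebraicGeometry.Resolution.NuEliminationThreadNE
import HarnessLib

/-!
# [OURS · L1 W4.2] σ-LAYER — `Corridor3SigmaMenuGateTameHigh`: THE TAME-HIGH PRESCRIPTION OF RECORD — slot (iii) of the tame gate at a TAME-HIGH point
# (`S ≥ m`): the RESTRICTED centre on the CJS surface germ satisfies the germ's PRESCRIPTION (instance OF RECORD: res-lit-3's `ThreadState.IsPrescribedCentre`,
# F-91d `Literature…NuEliminationThreadNE` p553058, with the thread state / history / value packed into the germ datum — the literal packing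
# `TameGermDatum.ofThread` is a v2 append the minute the farm builds that module; this file is deliberately import-free of it) (res-L1-w42-plan-1 RULINGS v3.14-45 (KR)/(KS), -47 (MF)(4), -48 (PC)/(PF) T-L7); the GERM READING is one parameter;
# and RULING v3.14-49 (RA)/(RC): TAME-MID splits by the point test `sncSurface` into MID-α (routes to an EXACT-type group gate `γeS` on the board with the
# extra ray `r_Σ`) and MID-β (the OPEN named hypothesis `TameMidPrescription`) — `GroupGate.midSplit sncSurface γeS TameMidPrescription` in the `mid` slot
# (crux chain w42 `SigmaMaxModifications` stmt-ResolutionOfSingularities-18506 / conjunct `SigmaMaxModificationsCorridor3` stmt-ResolutionOfSingularities-19249)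

OURS (cell res-hironaka, slot W4.2; typer res-L1-type-o1 g10); NOT statements of H. Hironaka's manuscript [Hironaka2017] nor of [CossartJannsenSaito2020];
AI-typed, weaker than expert review. Helper VOCABULARY `--supports stmt-ResolutionOfSingularities-19249 --as helper` (counted 0). Sibling of
`…SigmaMenuGateTameSplit` (`TameKind`, `GroupGate.tameByKind`, `CentreGate.ofRecordSplit`): here the HIGH branch `high := GroupGate.canonHigh germ` and the
assembled prescription / centre gate OF RECORD with it. The germ's prescription is carried ABSTRACTLY by the datum (`presc : traces → restricted centre → Prop`);
the instance of record is res-lit-3's `ThreadState.IsPrescribedCentre st 𝓑' 2 ν̃ O C'` (`IsBPermissible C' 𝓑' ∧ (point phase ∧ germ = the point ∨ ¬ point phase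
∧ germ = the least-label branch)`), so this file does not import `Literature…NuEliminationThreadNE` and survives that module's revisions; the thread FUEL
`CossartJannsenSaito2020_thm_6_28_thread_bound` (F-91d) is the consumer's (002 (γ)), not the gate's.

## Contents (namespace `…Theorems.SigmaMaxModificationsCorridor3.Sigma`)

* `TameGermDatum W` {`Z`, `ι : Z ⟶ W`, `presc : List Z.IdealSheafData → Z.IdealSheafData → Prop`} — the CJS surface germ at a point with ITS PRESCRIPTION
  (instance: `fun 𝓑' C' => ThreadState.IsPrescribedCentre st 𝓑' 2 ν̃ O C'` for the point's thread state `st`, germ history `O`, value `ν̃`);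
  `TameGermDatum.PrescCarriesBPermissible` (the instance's first conjunct, as a property of a datum); `TameGermReading` — which data sit at which point of which
  state ((G2), res-L1-type-o2 / 002; RUN START: `O₀ := 𝓑₀` ALL-OLD at LEVEL ENTRY, (5.11)-transported inside a `(ν, S)`-level — RULING v3.14-48 (PC), -46 (KW); a
  specification of the INSTANCE, the start of a level being path data).
* **`GroupGate.canonHigh germ`** — for every germ datum `d` at `g`: `d.presc (E.map (·.comap d.ι)) (C.comap d.ι)` (boundary TRACES, RESTRICTED centre);
  `canonHigh_isBPermissible_restrict` (datum carries `IsBPermissible` ⇒ `𝓑`-permissibility of the restricted centre ON THE GERM; lifting to `W` is (G2)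
  geometry, not claimed); `canonHigh_of_forall_not_mem` (no germ datum at `g` ⇒ passes — by design off the tame-high region).
* RULING v3.14-49 (RA)/(RC): the `mid` slot of record is `GroupGate.midSplit sncSurface γeS TameMidPrescription` (sibling `…MenuGateTameSplit` v2, PART C) (MID-α: `sncSurface g` — `Sing_{S₀}(N)` is 2-dimensional at `g` and its surface
  germ `Σ` is n.c. with `𝓑(g)` — routes to the EXACT-type group gate `γeS`, instance = procedure Q on the `TState` whose rays are `𝓑(g) ∪ {r_Σ}` with
  `expo r_Σ := S₀` (060/002's reading; `CentreGate.ofCorners`/`GroupGate` are typed over POINTS and an abstract gate, so no new constructor is needed here — the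
  extra ray lives in the instance); MID-β: the OPEN named hypothesis `TameMidPrescription`, row T-M0 proper).
* **`GroupGate.tamePrescriptionOfRecord tk sncSurface germ γeS low midWild surface := tameByKind tk low (midSplit sncSurface γeS midWild) (canonHigh germ) surface`**
  and **`CentreGate.ofRecordHigh corners face kind γe tamePts tk sncSurface germ γeS low midWild surface := ofRecordSplit … low (midSplit …) (canonHigh germ) surface`**
  (+ `ofRecordHigh_tameHigh`: at a TAME-HIGH point on a passing centre the restricted centre satisfies the prescription of every germ datum there; `ofRecordHigh_tameMidSnc`: at
  a MID-α point the extra-ray exact gate; `ofRecordHigh_tameMidWild`: at a MID-β point the open hypothesis).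
* §2 (v2 append) **`TameGermDatum.ofThread Z ι st O ν̃`** — the instance of record's packing over res-lit-3's `ThreadState` (imports
  `Literature…NuEliminationThreadNE`, built on the farm since 18:58Z): `ofThread_presc` (`Iff.rfl` to `IsPrescribedCentre`), `ofThread_prescCarriesBPermissible`,
  `GroupGate.canonHigh_ofThread` (slot (iii) on a thread datum = lit-3's prescription LITERALLY), `canonHigh_ofThread_isBPermissible`.
VACUITY: `canonHigh` is exactly as contentful as the germ reading; at a point carrying a germ datum it asserts that datum's prescription — with the instance of
record a genuine condition (fails for a centre whose germ is neither the point in phase (P1) nor the least-label branch in phase (P2)).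
-/

noncomputable section

set_option linter.dupNamespace false -- mandated namespace of this single-conjunct summit

open CategoryTheory AlgebraicGeometry TopologicalSpace
open Summit.ResolutionOfSingularities.ResolutionOfSingularities.Theorems.CampaignW42
open Literature.AlgebraicGeometry.Resolution Literature.RingTheory.HilbertSamuel

namespace Summit.ResolutionOfSingularities.ResolutionOfSingularities.Theorems.SigmaMaxModificationsCorridor3.Sigma

universe u

/-- [OURS · L1 W4.2] **A TAME GERM DATUM at a point of the stage `W`**: the CJS surface germ the TAME-HIGH tier plays on — a scheme `Z` (instance: `V(N) ∩ U ⊂ H`,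
the residual's zero locus on the maximal-contact hypersurface near the point) with its map `ι : Z ⟶ W`, the germ's PRESCRIPTION for restricted
centres given the boundary traces (instance of record: lit-3's `ThreadState.IsPrescribedCentre` for the point's thread state — thread point, global labels,
phase bit, curve history —, the germ's boundary history `O` and its refined value `ν̃`, at level `2`). NOT a statement of the manuscript. [cite: CossartJannsenSaito2020, Proof of Thm. 6.28 Steps 4–7 (LNM 2270, pp. 94–96)] -/
structure TameGermDatum (W : Scheme.{u}) : Type (u + 1) where
  /-- the surface germ -/
  Z : Scheme.{u}
  /-- its map to the stage (instance: a locally closed immersion `V(N) ∩ U ↪ W`) -/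
  ι : Z ⟶ W
  /-- THE GERM'S PRESCRIPTION: «for the boundary traces `𝓑'` on `Z`, the restricted centre `C'` is the prescribed one» (instance of record:
  `fun 𝓑' C' => ThreadState.IsPrescribedCentre st 𝓑' 2 ν̃ O C'`, res-lit-3's F-91d rule for the point's thread state, history and value) -/
  presc : List Z.IdealSheafData → Z.IdealSheafData → Prop

/-- [OURS · L1 W4.2] The datum's prescription CARRIES `𝓑`-PERMISSIBILITY on the germ (true for the instance of record: `IsPrescribedCentre`'s first conjunct is
`IsBPermissible C' 𝓑'`). [cite: CossartJannsenSaito2020, Def. 5.4] -/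
def TameGermDatum.PrescCarriesBPermissible {W : Scheme.{u}} (d : TameGermDatum W) : Prop :=
  ∀ (𝓑' : List d.Z.IdealSheafData) (C' : d.Z.IdealSheafData), d.presc 𝓑' C' → IsBPermissible C' 𝓑'

/-- [OURS · L1 W4.2] **A TAME GERM READING**: at a state and a point, the (set of) tame germ data there (empty off the tame-high region; a singleton where the
reading is defined). Instance: the 067/068-successor's (G2) reading. NOT a statement of the manuscript. [folklore] -/
abbrev TameGermReading : Type (u + 1) :=
  ∀ (W : Scheme.{u}), IsLocallyNoetherian W → ℕ → (ℕ → ℕ) → Labelling W → Option (Pending W) → Boundary W → W → Set (TameGermDatum W)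

/-- [OURS · L1 W4.2] **SLOT (iii), TAME-HIGH BRANCH, OVER lit-3's `IsPrescribedCentre`** (RULINGS v3.14-45 (KR)/(KS), -48 (PC); replaces the role of «the next
centre of `S(X, ν̃)` through the thread point» (LNM 2270 pp. 94–96) for OUR tame-high points; NOT a statement of the manuscript): the centre `C` passes at `g`
iff for every germ datum `d` the reading puts at `g`, the RESTRICTED centre `C|_Z = C.comap d.ι` satisfies the germ's PRESCRIPTION for the boundary TRACES
`E.map (·.comap d.ι)` (instance of record: `ThreadState.IsPrescribedCentre st traces 2 ν̃ O (C.comap d.ι)` for the thread state `st` at the point). [cite: CossartJannsenSaito2020, Proof of Thm. 6.28 Steps 5–7 (LNM 2270, pp. 94–96)] -/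
def GroupGate.canonHigh (germ : TameGermReading.{u}) : GroupGate.{u} :=
  fun W hW N ν L P E g C => ∀ d ∈ germ W hW N ν L P E g, d.presc (E.map fun B => B.comap d.ι) (C.comap d.ι)

section High

variable {germ : TameGermReading.{u}} {tk : TameKindReading.{u}} {low mid surface : GroupGate.{u}} {N : ℕ} {ν : ℕ → ℕ} {W : Scheme.{u}}
  {hW : IsLocallyNoetherian W} {L : Labelling W} {P : Option (Pending W)} {E : Boundary W} {g : W} {C : W.IdealSheafData}

/-- Unfolding (`Iff.rfl`). [folklore] -/
theorem GroupGate.canonHigh_iff :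
    GroupGate.canonHigh germ W hW N ν L P E g C ↔ ∀ d ∈ germ W hW N ν L P E g, d.presc (E.map fun B => B.comap d.ι) (C.comap d.ι) :=
  Iff.rfl

/-- **The high branch makes the RESTRICTED centre `𝓑`-permissible ON THE GERM for the boundary traces** when the datum's prescription carries it (the
instance of record does: first conjunct of `IsPrescribedCentre`). [cite: CossartJannsenSaito2020, Def. 5.4] -/
theorem GroupGate.canonHigh_isBPermissible_restrict (h : GroupGate.canonHigh germ W hW N ν L P E g C) {d : TameGermDatum W}
    (hd : d ∈ germ W hW N ν L P E g) (hp : d.PrescCarriesBPermissible) : IsBPermissible (C.comap d.ι) (E.map fun B => B.comap d.ι) :=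
  hp _ _ (h d hd)

/-- Where the reading carries no germ datum the high branch passes (off the tame-high region, by design). [folklore] -/
theorem GroupGate.canonHigh_of_forall_not_mem (h : ∀ d, d ∉ germ W hW N ν L P E g) : GroupGate.canonHigh germ W hW N ν L P E g C :=
  fun d hd => absurd hd (h d)

end High


/-- [OURS · L1 W4.2] **THE TAME PRESCRIPTION OF RECORD** (RULING v3.14-48 (PF) T-L7 as amended by -49 (RC)): `tameByKind` with HIGH := `canonHigh germ`, MID := `midSplit sncSurface γeS
TameMidPrescription` (MID-α ↦ the EXACT-type group gate `γeS` on the board with the extra ray `r_Σ`; MID-β ↦ the OPEN named hypothesis `TameMidPrescription`, row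
T-M0 proper), LOW/SURFACE the named hypotheses (`TameLowPrescription`: the lineage point while base points remain or snc fails, else the Q₂-face of the `H₂`
board, (PD); `TameSurfacePrescription`: (G10a/b)). Plugs as `canon` into `CentreGate.tamePrescribed tamePts canon`. NOT a statement of the manuscript. [folklore] -/
def GroupGate.tamePrescriptionOfRecord (tk : TameKindReading.{u}) (sncSurface : PointReading.{u}) (germ : TameGermReading.{u})
    (γeS TameLowPrescription TameMidPrescription TameSurfacePrescription : GroupGate.{u}) : GroupGate.{u} :=
  GroupGate.tameByKind tk TameLowPrescription (GroupGate.midSplit sncSurface γeS TameMidPrescription) (GroupGate.canonHigh germ)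
    TameSurfacePrescription

/-- [OURS · L1 W4.2] **THE CENTRE GATE OF RECORD with the HIGH branch of record** — `CentreGate.ofRecordSplit` with `high := GroupGate.canonHigh germ`; the term
002 (γ) plugs once the readings exist. NOT a statement of the manuscript. [folklore] -/
def CentreGate.ofRecordHigh (corners : CornerReading.{u}) (face : GroupGate.{u}) (kind : CornerKindReading.{u}) (γe : GroupGate.{u})
    (tamePts : CornerReading.{u}) (tk : TameKindReading.{u}) (sncSurface : PointReading.{u}) (germ : TameGermReading.{u})
    (γeS TameLowPrescription TameMidPrescription TameSurfacePrescription : GroupGate.{u}) : CentreGate.{u} :=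
  CentreGate.ofRecordSplit corners face kind γe tamePts tk TameLowPrescription (GroupGate.midSplit sncSurface γeS TameMidPrescription)
    (GroupGate.canonHigh germ) TameSurfacePrescription

section Record

variable {corners tamePts : CornerReading.{u}} {face γe γeS low midWild surface : GroupGate.{u}} {kind : CornerKindReading.{u}} {tk : TameKindReading.{u}}
  {sncSurface : PointReading.{u}} {germ : TameGermReading.{u}} {N : ℕ} {ν : ℕ → ℕ} {W : Scheme.{u}} {hW : IsLocallyNoetherian W} {L : Labelling W}
  {P : Option (Pending W)} {E : Boundary W} {g : W} {C : W.IdealSheafData}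

/-- Unfolding (`rfl`). [folklore] -/
theorem GroupGate.tamePrescriptionOfRecord_eq :
    GroupGate.tamePrescriptionOfRecord tk sncSurface germ γeS low midWild surface =
      GroupGate.tameByKind tk low (GroupGate.midSplit sncSurface γeS midWild) (GroupGate.canonHigh germ) surface :=
  rfl

/-- Unfolding (`rfl`). [folklore] -/
theorem CentreGate.ofRecordHigh_eq :
    CentreGate.ofRecordHigh corners face kind γe tamePts tk sncSurface germ γeS low midWild surface =
      CentreGate.ofRecordSplit corners face kind γe tamePts tk low (GroupGate.midSplit sncSurface γeS midWild) (GroupGate.canonHigh germ) surface :=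
  rfl

/-- **At a TAME-HIGH point on a centre passing the gate of record, the restricted centre satisfies the prescription of every germ datum there** (instance of
record: lit-3's `IsPrescribedCentre`). [cite: CossartJannsenSaito2020, Proof of Thm. 6.28 Steps 5–7 (LNM 2270, pp. 94–96)] -/
theorem CentreGate.ofRecordHigh_tameHigh (h : CentreGate.ofRecordHigh corners face kind γe tamePts tk sncSurface germ γeS low midWild surface W hW N ν L P E C)
    (hx : g ∈ tamePts W hW N ν L P E) (hxC : g ∈ (C.support : Set W)) (hk : tk W hW N ν L P E g = .high) {d : TameGermDatum W}
    (hd : d ∈ germ W hW N ν L P E g) : d.presc (E.map fun B => B.comap d.ι) (C.comap d.ι) :=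
  CentreGate.ofRecordSplit_tameHigh h hx hxC hk d hd

/-- **At a MID-α point (`sncSurface g`) on a passing centre: the extra-ray EXACT-type gate `γeS`.** [folklore] -/
theorem CentreGate.ofRecordHigh_tameMidSnc (h : CentreGate.ofRecordHigh corners face kind γe tamePts tk sncSurface germ γeS low midWild surface W hW N ν L P E C)
    (hx : g ∈ tamePts W hW N ν L P E) (hxC : g ∈ (C.support : Set W)) (hk : tk W hW N ν L P E g = .mid) (hs : sncSurface W hW N ν L P E g) :
    γeS W hW N ν L P E g C :=
  CentreGate.ofRecordSplit_tameMidSnc h hx hxC hk hs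

/-- **At a MID-β point (`¬ sncSurface g`) on a passing centre: the OPEN named hypothesis** (row T-M0 proper). [folklore] -/
theorem CentreGate.ofRecordHigh_tameMidWild (h : CentreGate.ofRecordHigh corners face kind γe tamePts tk sncSurface germ γeS low midWild surface W hW N ν L P E C)
    (hx : g ∈ tamePts W hW N ν L P E) (hxC : g ∈ (C.support : Set W)) (hk : tk W hW N ν L P E g = .mid) (hs : ¬ sncSurface W hW N ν L P E g) :
    midWild W hW N ν L P E g C :=
  CentreGate.ofRecordSplit_tameMidWild h hx hxC hk hs

end Record


/-! ## §2. (appended 2026-08-27, same seat, v2) THE INSTANCE OF RECORD'S PACKING — a germ datum FROM A THREAD STATE (res-lit-3's F-91d `ThreadState`,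
`Literature…NuEliminationThreadNE` p553058, now built on the farm): `TameGermDatum.ofThread Z ι st O ν̃` with `presc := fun 𝓑' C' => st.IsPrescribedCentre 𝓑' 2 ν̃ O C'`,
so that `GroupGate.canonHigh` on such data IS LITERALLY «the restricted centre is the thread's prescribed centre for the boundary traces» (RULING v3.14-48 T-L7
«tameHigh over lit-3's `ThreadState.IsPrescribedCentre`»). -/

section OfThread

variable {W : Scheme.{u}}

/-- [OURS · L1 W4.2] **THE GERM DATUM OF A THREAD STATE** (the instance of record's packing): the germ `Z` with its map `ι`, and the prescription «`C'` is the
PRESCRIBED centre of the thread state `st` for the traces `𝓑'`, level `2`, value `ν̃`, history `O`» = res-lit-3's `ThreadState.IsPrescribedCentre` (Proof of Thm. 6.28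
Steps 5–7 at the thread point: `𝓑'`-permissible ∧ germ = the point in the point phase, else the least-label branch). NOT a statement of the manuscript.
[cite: CossartJannsenSaito2020, Proof of Thm. 6.28 Steps 5–7 (LNM 2270, pp. 94–96)] -/
def TameGermDatum.ofThread (Z : Scheme.{u}) (ι : Z ⟶ W) (st : ThreadState Z) (O : Z → Set ℕ) (ν' : (ℕ → ℕ) ×ₗ ℕ) : TameGermDatum W :=
  ⟨Z, ι, fun 𝓑' C' => st.IsPrescribedCentre 𝓑' 2 ν' O C'⟩

variable (Z : Scheme.{u}) (ι : Z ⟶ W) (st : ThreadState Z) (O : Z → Set ℕ) (ν' : (ℕ → ℕ) ×ₗ ℕ)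

/-- Unfolding (`rfl`). [folklore] -/
@[simp] theorem TameGermDatum.ofThread_Z : (TameGermDatum.ofThread Z ι st O ν').Z = Z := rfl

/-- Unfolding (`rfl`). [folklore] -/
@[simp] theorem TameGermDatum.ofThread_ι : (TameGermDatum.ofThread Z ι st O ν').ι = ι := rfl

/-- Unfolding (`Iff.rfl`): the packed prescription IS lit-3's `IsPrescribedCentre`. [folklore] -/
theorem TameGermDatum.ofThread_presc (𝓑' : List Z.IdealSheafData) (C' : Z.IdealSheafData) :
    (TameGermDatum.ofThread Z ι st O ν').presc 𝓑' C' ↔ st.IsPrescribedCentre 𝓑' 2 ν' O C' :=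
  Iff.rfl

/-- **The thread datum's prescription carries `𝓑`-permissibility** (`IsPrescribedCentre`'s first conjunct). [cite: CossartJannsenSaito2020, Def. 5.4] -/
theorem TameGermDatum.ofThread_prescCarriesBPermissible : (TameGermDatum.ofThread Z ι st O ν').PrescCarriesBPermissible :=
  fun _ _ h => h.1

variable {Z ι st O ν'} {germ : TameGermReading.{u}} {N : ℕ} {ν : ℕ → ℕ} {hW : IsLocallyNoetherian W} {L : Labelling W} {P : Option (Pending W)}
  {E : Boundary W} {g : W} {C : W.IdealSheafData}

/-- **TAME-HIGH SLOT (iii) ON A THREAD DATUM, LITERALLY**: if the reading puts `ofThread Z ι st O ν̃` at `g` and the centre passes `canonHigh`, then the restricted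
centre `C.comap ι` is the thread's PRESCRIBED centre for the traces `E.map (·.comap ι)` in lit-3's sense.
[cite: CossartJannsenSaito2020, Proof of Thm. 6.28 Steps 5–7 (LNM 2270, pp. 94–96)] -/
theorem GroupGate.canonHigh_ofThread (h : GroupGate.canonHigh germ W hW N ν L P E g C) (hd : TameGermDatum.ofThread Z ι st O ν' ∈ germ W hW N ν L P E g) :
    st.IsPrescribedCentre (E.map fun B => B.comap ι) 2 ν' O (C.comap ι) :=
  h _ hd

/-- … hence the restricted centre is `𝓑`-permissible on the germ for the traces. [cite: CossartJannsenSaito2020, Def. 5.4] -/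
theorem GroupGate.canonHigh_ofThread_isBPermissible (h : GroupGate.canonHigh germ W hW N ν L P E g C)
    (hd : TameGermDatum.ofThread Z ι st O ν' ∈ germ W hW N ν L P E g) : IsBPermissible (C.comap ι) (E.map fun B => B.comap ι) :=
  (h _ hd).1

end OfThread

end Summit.ResolutionOfSingularities.ResolutionOfSingularities.Theorems.SigmaMaxModificationsCorridor3.Sigma

end
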